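import Literature.AlgebraicGeometry.Frobenioids.ModelFrobenioidSelfEquivalenceRigidityUnits
import HarnessLib

/-!
# Frobenioids I, Thm. 5.2 (iv) / Prop. 5.6: rigidity over the identity of the base — the hypothesis in the
# `O^▷`-form ("`Ψ` induces the identity on the monoids `O^▷(A)` of base-identity linear endomorphisms") for
# divisor monoids of RANK ONE (total divisibility), e.g. `p`-adic Frobenioids

Mochizuki, *The geometry of Frobenioids I: the general theory*, Kyushu J. Math. **62** (2008) 293–400, §5,
Theorem 5.2 (i)/(ii)/(iv) pp. 100–103 (the rational function monoid of the model Frobenioid is `B`; on an object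
`A` it is read on the base-identity linear endomorphisms `(1, id, Div_B(u)⁺, u)`, i.e. on `O^▷(A)`), Proposition 5.6
p. 105 [cite: MochizukiFrdI2008, Thm. 5.2 p.100]; [FrdII] Example 1.1 (ii) p. 8 (the `p`-adic Frobenioid: `Φ ⊆
ord(𝒪^▷) ⊗ ℝ_{≥0}` monoprime — a RANK-ONE divisor monoid: of two elements one divides the other); consumer locus
[IUTchI] Cor. 5.3 (ii)/(iv) pp. 144–145 [cite: Mochizuki2012, Cor. 5.3(iv) p.145].

PROOF-ONLY sequel of `ModelFrobenioidSelfEquivalenceRigidityUnits.lean` (abc-iut, rows «S2′»/«S2c», this file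
abc-iut-L1-t7).  `ratio_of_endUnits`: if the divisor monoids `Φ(A)` are TOTALLY ORDERED BY DIVISIBILITY (`hΦ`) and
`B` is objectwise group-like, then «`Ψ` induces through `e` the identity on every base-identity linear ENDOMORPHISM»
(`hO : u_{Ψ τ} = e_X^* u_τ` for `τ : X → X`, `deg_Fr τ = 1`, `Base τ = id` — the shape in which [FrdI] Thm. 3.4 (iv) /
[FrdII] Thm. 2.4 deliver the unit transport of an equivalence, cf. `PadicFrd.Datum.exists_psiB_of_equivalence`)
implies the birational-ratio hypothesis `hratio` of the parent file: of two parallel linear arrows `f, g` one is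
`τ ∘ g` for such a `τ` with `u_τ = u_f / u_g`.  Hence `exists_iso_id_of_over_base_of_endUnits` and its `η` /
`C ≌ C` forms: **over a rank-one divisor monoid, a self-equivalence over the identity of the base that preserves
Frobenius degrees and divisors and fixes the units of base-identity linear endomorphisms is `≅ 𝟭`.**
No statement of either paper is restated as a fact; nothing here bears on [IUTchIII] Cor. 3.12.
-/

namespace Literature.AlgebraicGeometry.Frobenioids

open CategoryTheory Opposite

universe w v u

namespace ModelFrobenioid

variable {D : Type u} [Category.{v} D] {Φ B : Dᵒᵖ ⥤ CommMonCat.{w}} {DivB : B ⟶ monoidGp Φ}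
  {Ψ : ModelFrobenioid Φ B DivB ⥤ ModelFrobenioid Φ B DivB}
  (e : ∀ X : ModelFrobenioid Φ B DivB, (Ψ.obj X).base ≅ X.base)
  (hen : ∀ ⦃X Y : ModelFrobenioid Φ B DivB⦄ (φ : X ⟶ Y),
    baseMap (Ψ.map φ) ≫ (e Y).hom = (e X).hom ≫ baseMap φ)
  (hdeg : ∀ ⦃X Y : ModelFrobenioid Φ B DivB⦄ (φ : X ⟶ Y), degFr (Ψ.map φ) = degFr φ)
  (hB : ∀ (A : Dᵒᵖ) (b : B.obj A), IsUnit b)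
  (hΦ : ∀ (A : Dᵒᵖ) (z z' : Φ.obj A), (∃ w, z = z' * w) ∨ (∃ w, z' = z * w))
  (hO : ∀ (X : ModelFrobenioid Φ B DivB) (τ : X ⟶ X), degFr τ = 1 → baseMap τ = 𝟙 X.base →
    unit (Ψ.map τ) = pull B (e X).hom (unit τ))

section Ratio

include hen hdeg hB hO in
/-- One half of `ratio_of_endUnits`: if `Div(f) = Div(g) + w`, then `f = τ ∘ g`... rather `f = g ∘ τ`-in-diagrammatic
order `f = τ ≫ g` for the base-identity linear endomorphism `τ = (1, id, w, u_f − u_g)` of the source, so `hO`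
transports the birational unit `u_f − u_g`. [cite: MochizukiFrdI2008, Thm. 5.2(iv) p.102] -/
theorem ratio_of_endUnits_of_dvd {X Y : ModelFrobenioid Φ B DivB} (f g : X ⟶ Y) (hf : degFr f = 1)
    (hg : degFr g = 1) (hb : baseMap f = baseMap g) (w : Φ.obj (op X.base)) (hw : div f = div g * w) :
    unit (Ψ.map f) * pull B (e X).hom (unit g) = unit (Ψ.map g) * pull B (e X).hom (unit f) := by
  obtain ⟨ug, hug⟩ := hB _ (unit g)
  -- `w = Div_B(u_f / u_g)` from the two relations (d)
  have hrf := rel f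
  have hrg := rel g
  rw [hf, PNat.one_coe, pow_one, hw, map_mul] at hrf
  rw [hg, PNat.one_coe, pow_one, ← hb] at hrg
  have hwr : Algebra.GrothendieckGroup.of w = divB Φ B DivB (op X.base) (unit f * ↑ug⁻¹) := by
    have h : pullGp Φ (baseMap f) Y.cls * (divB Φ B DivB (op X.base) (unit g) * Algebra.GrothendieckGroup.of w) =
        pullGp Φ (baseMap f) Y.cls * divB Φ B DivB (op X.base) (unit f) := by
      rw [← mul_assoc, ← hrg, mul_assoc, hrf]
    have h₁ : divB Φ B DivB (op X.base) (unit g) * Algebra.GrothendieckGroup.of w =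
        divB Φ B DivB (op X.base) (unit f) := mul_left_cancel h
    calc Algebra.GrothendieckGroup.of w
        = Algebra.GrothendieckGroup.of w * divB Φ B DivB (op X.base) (↑ug * ↑ug⁻¹) := by
          rw [Units.mul_inv, map_one, mul_one]
      _ = divB Φ B DivB (op X.base) ↑ug * Algebra.GrothendieckGroup.of w * divB Φ B DivB (op X.base) ↑ug⁻¹ := by
          rw [map_mul]; ac_rfl
      _ = divB Φ B DivB (op X.base) (unit f) * divB Φ B DivB (op X.base) ↑ug⁻¹ := by rw [hug, h₁]
      _ = divB Φ B DivB (op X.base) (unit f * ↑ug⁻¹) := by rw [map_mul]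
  -- the endomorphism `τ = (1, id, w, u_f u_g⁻¹)` with `f = τ ≫ g`
  let τ : X ⟶ X := mkHom _ _ 1 (𝟙 X.base) w (unit f * ↑ug⁻¹ :) (by
    rw [PNat.one_coe, pow_one, pullGp_id, hwr])
  have hfac : f = τ ≫ g := by
    refine hom_ext ?_ ?_ ?_ ?_
    · show degFr f = degFr g * 1
      rw [hf, hg, mul_one]
    · show baseMap f = 𝟙 X.base ≫ baseMap g
      rw [Category.id_comp, hb]
    · show div f = pull Φ (𝟙 X.base) (div g) * w ^ (degFr g : ℕ)
      rw [pull_id, hg, PNat.one_coe, pow_one, hw]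
    · show unit f = pull B (𝟙 X.base) (unit g) * (unit f * ↑ug⁻¹) ^ (degFr g : ℕ)
      rw [pull_id, hg, PNat.one_coe, pow_one, ← hug, mul_left_comm, Units.mul_inv, mul_one]
  -- `Base(Ψ τ) = id`, `deg_Fr(Ψ g) = 1`
  have hbτ : baseMap (Ψ.map τ) = 𝟙 (Ψ.obj X).base := by
    have h := hen τ
    rw [show baseMap τ = 𝟙 X.base from rfl, Category.comp_id] at h
    exact (cancel_mono (e X).hom).mp (h.trans (Category.id_comp _).symm)
  have hΨf : unit (Ψ.map f) = unit (Ψ.map g) * pull B (e X).hom (unit τ) := by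
    have hmap : Ψ.map f = Ψ.map τ ≫ Ψ.map g := by rw [hfac, Functor.map_comp]
    rw [hmap, unit_comp_pull, hbτ, pull_id, hdeg, hg, PNat.one_coe, pow_one, hO X τ rfl rfl]
  rw [hΨf, mul_assoc, ← map_mul]
  show unit (Ψ.map g) * pull B (e X).hom (unit f * ↑ug⁻¹ * unit g) = unit (Ψ.map g) * pull B (e X).hom (unit f)
  rw [← hug, mul_assoc, Units.inv_mul, mul_one]

include hen hdeg hB hΦ hO in
/-- **`O^▷`-form ⇒ birational-ratio form** over a rank-one divisor monoid: «`Ψ` fixes through `e` the unit of every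
base-identity linear endomorphism» implies `hratio` (the birational unit `u_f − u_g` of two parallel linear arrows over
the same base arrow is preserved) — of `Div(f)`, `Div(g)` one divides the other.
[cite: MochizukiFrdI2008, Thm. 5.2(iv) p.102] -/
theorem ratio_of_endUnits {X Y : ModelFrobenioid Φ B DivB} (f g : X ⟶ Y) (hf : degFr f = 1)
    (hg : degFr g = 1) (hb : baseMap f = baseMap g) :
    unit (Ψ.map f) * pull B (e X).hom (unit g) = unit (Ψ.map g) * pull B (e X).hom (unit f) := by
  rcases hΦ (op X.base) (div f) (div g) with ⟨w, hw⟩ | ⟨w, hw⟩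
  · exact ratio_of_endUnits_of_dvd e hen hdeg hB hO f g hf hg hb w hw
  · exact (ratio_of_endUnits_of_dvd e hen hdeg hB hO g f hg hf hb.symm w hw).symm

end Ratio

section Rigidity

include hen hdeg hB hΦ hO in
/-- **Rigidity over a rank-one divisor monoid, `O^▷`-form** ([FrdI] Thm. 5.2 (iv) / Prop. 5.6; [IUTchI] Cor. 5.3
(ii)/(iv) injectivity criterion at a `p`-adic-type model Frobenioid): `Ψ : C ⥤ C` lying over the identity of the base
(natural `e_X`), preserving Frobenius degrees, inducing the identity on the divisor monoid and — through `e` — fixing the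
unit of every base-identity linear endomorphism, with `B` group-like and `Φ` totally ordered by divisibility, is
`≅ 𝟭_C` with components `(1, e_X, 0, ω_X)`. [cite: MochizukiFrdI2008, Thm. 5.2(iv) p.102]
[cite: Mochizuki2012, Cor. 5.3(iv) p.145] -/
theorem exists_iso_id_of_over_base_of_endUnits
    (hdiv : ∀ ⦃X Y : ModelFrobenioid Φ B DivB⦄ (φ : X ⟶ Y), div (Ψ.map φ) = pull Φ (e X).hom (div φ)) :
    ∃ ι : Ψ ≅ 𝟭 (ModelFrobenioid Φ B DivB), ∀ X : ModelFrobenioid Φ B DivB,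
      degFr (ι.hom.app X) = 1 ∧ baseMap (ι.hom.app X) = (e X).hom ∧ div (ι.hom.app X) = 1 :=
  exists_iso_id_of_over_base_of_ratio e hen hdeg hdiv hB (fun _ _ f g hf hg hb =>
    ratio_of_endUnits e hen hdeg hB hΦ hO f g hf hg hb)

include hen hdeg hB hΦ hO in
/-- The same, as a bare existence statement. [cite: MochizukiFrdI2008, Thm. 5.2(iv) p.102] -/
theorem nonempty_iso_id_of_over_base_of_endUnits
    (hdiv : ∀ ⦃X Y : ModelFrobenioid Φ B DivB⦄ (φ : X ⟶ Y), div (Ψ.map φ) = pull Φ (e X).hom (div φ)) :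
    Nonempty (Ψ ≅ 𝟭 (ModelFrobenioid Φ B DivB)) := by
  obtain ⟨ι, -⟩ := exists_iso_id_of_over_base_of_endUnits e hen hdeg hB hΦ hO hdiv
  exact ⟨ι⟩

end Rigidity

section OverBaseIso

include hB hΦ

/-- **`O^▷`-form, natural-isomorphism version** (`η : Ψ ⋙ Base ≅ Base`). [cite: MochizukiFrdI2008, Thm. 5.2(iv) p.102]
[cite: Mochizuki2012, Cor. 5.3(iv) p.145] -/
theorem nonempty_iso_id_of_over_baseIso_of_endUnits (η : Ψ ⋙ baseFunctor Φ B DivB ≅ baseFunctor Φ B DivB)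
    (hdeg : ∀ ⦃X Y : ModelFrobenioid Φ B DivB⦄ (φ : X ⟶ Y), degFr (Ψ.map φ) = degFr φ)
    (hdiv : ∀ ⦃X Y : ModelFrobenioid Φ B DivB⦄ (φ : X ⟶ Y),
      div (Ψ.map φ) = pull Φ (η.hom.app X : (Ψ.obj X).base ⟶ X.base) (div φ))
    (hO : ∀ (X : ModelFrobenioid Φ B DivB) (τ : X ⟶ X), degFr τ = 1 → baseMap τ = 𝟙 X.base →
      unit (Ψ.map τ) = pull B (A := X.base) (B := (Ψ.obj X).base) (η.hom.app X) (unit τ)) :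
    Nonempty (Ψ ≅ 𝟭 (ModelFrobenioid Φ B DivB)) :=
  nonempty_iso_id_of_over_base_of_endUnits (fun X => η.app X) (fun _ _ φ => η.hom.naturality φ) hdeg hB hΦ hO hdiv

/-- **«FRDI-SELFEQUIV-RIGIDITY», `O^▷`-form, printed shape** — for a self-equivalence `Ψ : C ≌ C` of a model Frobenioid
with rank-one divisor monoids and group-like `B` lying over the identity of the base: preserving Frobenius degrees and
divisors and fixing (through `η`) the units of base-identity linear endomorphisms ⇒ `Ψ ≅ 𝟭`.
[cite: MochizukiFrdI2008, Thm. 5.2(iv) p.102] [cite: Mochizuki2012, Cor. 5.3(iv) p.145] -/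
theorem selfEquivalence_iso_id_of_over_base_of_endUnits
    (Ψ : ModelFrobenioid Φ B DivB ≌ ModelFrobenioid Φ B DivB)
    (η : Ψ.functor ⋙ baseFunctor Φ B DivB ≅ baseFunctor Φ B DivB)
    (hdeg : ∀ ⦃X Y : ModelFrobenioid Φ B DivB⦄ (φ : X ⟶ Y), degFr (Ψ.functor.map φ) = degFr φ)
    (hdiv : ∀ ⦃X Y : ModelFrobenioid Φ B DivB⦄ (φ : X ⟶ Y),
      div (Ψ.functor.map φ) = pull Φ (η.hom.app X : (Ψ.functor.obj X).base ⟶ X.base) (div φ))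
    (hO : ∀ (X : ModelFrobenioid Φ B DivB) (τ : X ⟶ X), degFr τ = 1 → baseMap τ = 𝟙 X.base →
      unit (Ψ.functor.map τ) = pull B (A := X.base) (B := (Ψ.functor.obj X).base) (η.hom.app X) (unit τ)) :
    Nonempty (Ψ.functor ≅ 𝟭 (ModelFrobenioid Φ B DivB)) :=
  nonempty_iso_id_of_over_baseIso_of_endUnits hB hΦ η hdeg hdiv hO

end OverBaseIso

end ModelFrobenioid

end Literature.AlgebraicGeometry.Frobenioids
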